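import Mathlib

/-!
# K2 lane (route-2 `SawtoothPulseCascade`, crux dir `K1LocalisedCascade`): the comb-column Duhamel envelope — row multiplier, `arsinh` integral

Helper file of the K2 lane (ACL item stmt-AnomalousDissipation-19491; E5 tail of the S4 line, arbiter A26-12/A26-13 «P2-T»). The abstract
envelope step of the comb-column creation law: if the propagator row is `cos(ω(θ−s))·1 + (sin(ω(θ−s))/ω)·X` with a PURELY IMAGINARY diagonal entry
`x₀` of modulus `≥ ω` (the Kelvin–Helmholtz block: `x₀ = −i·a·p`, `ω = a√(p² − 4|S|²)`), then `‖cos + (sin/ω)x₀‖ ≤ ‖x₀‖/ω` (`norm_row_multiplier_le`: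
the row acts as a unimodular phase up to `‖x₀‖/ω − 1 = O(e^{−2πa})`), and a source with pointwise Lorentzian envelope `E/√(1+s²)` creates, after strain `θ`,
an amplitude `≤ (‖x₀‖‖c₀‖ + ‖x₁‖‖c₁‖)/ω · E · arsinh θ` (`norm_duhamel_envelope_le`, `…_le'`); `∫₀^θ ds/√(1+s²) = arsinh θ`
(`integral_inv_sqrt_one_add_sq`) and `arsinh 8 ≤ 2.777` (`arsinh_eight_le`). No definitions; no statement about the crux. [folklore] [problem: turb]
-/

-- `Summit.<Summit>.<Problem>`: single-conjunct summit, the duplicate namespace segment is deliberate.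
set_option linter.dupNamespace false

noncomputable section

namespace Summit.AnomalousDissipation.AnomalousDissipation.Theorems.SawtoothPulseCascade.K2PhaseBudget

open Set MeasureTheory intervalIntegral

/-! ## §1 The envelope integral `∫₀^θ ds/√(1+s²) = arsinh θ` and the number `arsinh 8 ≤ 2.777` -/

/-- `√(1+s²) ≠ 0`. [folklore] -/
theorem sqrt_one_add_sq_ne_zero (s : ℝ) : Real.sqrt (1 + s ^ 2) ≠ 0 := (Real.sqrt_pos.2 (by positivity)).ne'

/-- The envelope `s ↦ (√(1+s²))⁻¹` is continuous. [folklore] -/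
theorem continuous_inv_sqrt_one_add_sq : Continuous fun s : ℝ => (Real.sqrt (1 + s ^ 2))⁻¹ :=
  Continuous.inv₀ (by fun_prop) sqrt_one_add_sq_ne_zero

/-- The envelope `s ↦ E/√(1+s²)` is continuous. [folklore] -/
theorem continuous_envelope (E : ℝ) : Continuous fun s : ℝ => E / Real.sqrt (1 + s ^ 2) :=
  Continuous.div continuous_const (by fun_prop) sqrt_one_add_sq_ne_zero

/-- `∫₀^θ ds/√(1+s²) = arsinh θ`. [folklore] -/
theorem integral_inv_sqrt_one_add_sq (θ : ℝ) :
    ∫ s in (0 : ℝ)..θ, (Real.sqrt (1 + s ^ 2))⁻¹ = Real.arsinh θ := by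
  have h := intervalIntegral.integral_eq_sub_of_hasDerivAt (a := 0) (b := θ) (f := Real.arsinh)
    (f' := fun s => (Real.sqrt (1 + s ^ 2))⁻¹) (fun s _ => Real.hasDerivAt_arsinh s)
    (continuous_inv_sqrt_one_add_sq.intervalIntegrable _ _)
  rw [h, Real.arsinh_zero, sub_zero]

/-- `∫₀^θ E/√(1+s²) ds = E · arsinh θ`. [folklore] -/
theorem integral_envelope (E θ : ℝ) :
    ∫ s in (0 : ℝ)..θ, E / Real.sqrt (1 + s ^ 2) = E * Real.arsinh θ := by
  rw [← integral_inv_sqrt_one_add_sq, ← intervalIntegral.integral_const_mul]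
  refine intervalIntegral.integral_congr fun s _ => ?_
  simp only [div_eq_mul_inv]

/-- `arsinh 8 = log(8 + √65) ≤ 2.777` (`√65 ≤ 8.0623`, `log 16 = 4 log 2`, `log 2 < 0.6931471808`, `log(1+x) ≤ x`). [folklore] -/
theorem arsinh_eight_le : Real.arsinh 8 ≤ 2.777 := by
  rw [Real.arsinh]
  have hs : Real.sqrt (1 + (8 : ℝ) ^ 2) ≤ 8.0623 := by
    rw [show (8.0623 : ℝ) = Real.sqrt (8.0623 ^ 2) by rw [Real.sqrt_sq (by norm_num)]]
    exact Real.sqrt_le_sqrt (by norm_num)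
  have hpos : (0 : ℝ) < 8 + Real.sqrt (1 + 8 ^ 2) := by positivity
  have h1 : Real.log (8 + Real.sqrt (1 + (8 : ℝ) ^ 2)) ≤ Real.log (16 * 1.00389375) :=
    Real.log_le_log hpos (by linarith)
  have h2 : Real.log (16 * 1.00389375) = 4 * Real.log 2 + Real.log 1.00389375 := by
    rw [Real.log_mul (by norm_num) (by norm_num), show (16 : ℝ) = 2 ^ 4 by norm_num, Real.log_pow]; push_cast; ring
  have h3 : Real.log (1.00389375 : ℝ) ≤ 1.00389375 - 1 := Real.log_le_sub_one_of_pos (by norm_num)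
  have h4 := Real.log_two_lt_d9
  linarith

/-! ## §2 The row multiplier of the stable block -/

/-- **Row multiplier.** For a purely imaginary `x₀` with `‖x₀‖ ≥ ω > 0`: `‖cos φ + (sin φ/ω)·x₀‖ ≤ ‖x₀‖/ω`. [folklore] -/
theorem norm_row_multiplier_le {x₀ : ℂ} {ω : ℝ} (hx₀ : x₀.re = 0) (hω : 0 < ω) (hωx : ω ≤ ‖x₀‖) (φ : ℝ) :
    ‖(Real.cos φ : ℂ) + ((Real.sin φ / ω : ℝ) : ℂ) * x₀‖ ≤ ‖x₀‖ / ω := by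
  have hn : ‖x₀‖ = |x₀.im| := by
    rw [Complex.norm_def, Complex.normSq_apply, hx₀, mul_zero, zero_add, Real.sqrt_mul_self_eq_abs]
  have hre : ((Real.cos φ : ℂ) + ((Real.sin φ / ω : ℝ) : ℂ) * x₀).re = Real.cos φ := by
    simp only [Complex.add_re, Complex.mul_re, Complex.ofReal_re, Complex.ofReal_im, hx₀, mul_zero, zero_mul, sub_zero, add_zero]
  have him : ((Real.cos φ : ℂ) + ((Real.sin φ / ω : ℝ) : ℂ) * x₀).im = Real.sin φ / ω * x₀.im := by
    simp only [Complex.add_im, Complex.mul_im, Complex.ofReal_re, Complex.ofReal_im, hx₀, mul_zero, zero_add, add_zero]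
  rw [Complex.norm_def, Complex.normSq_apply, hre, him]
  have hr : 1 ≤ ‖x₀‖ / ω := by rw [le_div_iff₀ hω]; linarith
  have hr0 : 0 ≤ ‖x₀‖ / ω := by positivity
  calc Real.sqrt (Real.cos φ * Real.cos φ + Real.sin φ / ω * x₀.im * (Real.sin φ / ω * x₀.im))
      ≤ Real.sqrt ((‖x₀‖ / ω) ^ 2) := by
        apply Real.sqrt_le_sqrt
        have hcs := Real.cos_sq_add_sin_sq φ
        have e : Real.sin φ / ω * x₀.im * (Real.sin φ / ω * x₀.im) = Real.sin φ ^ 2 * (‖x₀‖ / ω) ^ 2 := by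
          rw [hn, div_pow, sq_abs]; ring
        rw [e]
        have hr2 : 1 ≤ (‖x₀‖ / ω) ^ 2 := by nlinarith
        nlinarith [mul_nonneg (sub_nonneg.2 hr2) (sq_nonneg (Real.cos φ))]
    _ = ‖x₀‖ / ω := Real.sqrt_sq hr0

/-- Pointwise bound of the Duhamel integrand (main term first): `‖cos·(c₀S₀) + (sin/ω)(x₀c₀S₀ + x₁c₁S₁)‖ ≤ (‖x₀‖‖c₀‖‖S₀‖ + ‖x₁‖‖c₁‖‖S₁‖)/ω`.
[folklore] -/
theorem norm_duhamel_integrand_le {x₀ x₁ c₀ c₁ S₀ S₁ : ℂ} {ω : ℝ} (hx₀ : x₀.re = 0) (hω : 0 < ω) (hωx : ω ≤ ‖x₀‖) (φ : ℝ) :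
    ‖(Real.cos φ : ℂ) * (c₀ * S₀) + ((Real.sin φ / ω : ℝ) : ℂ) * (x₀ * (c₀ * S₀) + x₁ * (c₁ * S₁))‖ ≤
      (‖x₀‖ * ‖c₀‖ * ‖S₀‖ + ‖x₁‖ * ‖c₁‖ * ‖S₁‖) / ω := by
  have e : (Real.cos φ : ℂ) * (c₀ * S₀) + ((Real.sin φ / ω : ℝ) : ℂ) * (x₀ * (c₀ * S₀) + x₁ * (c₁ * S₁)) =
      ((Real.cos φ : ℂ) + ((Real.sin φ / ω : ℝ) : ℂ) * x₀) * (c₀ * S₀) + ((Real.sin φ / ω : ℝ) : ℂ) * x₁ * (c₁ * S₁) := by ring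
  rw [e]
  have h1 := norm_row_multiplier_le hx₀ hω hωx φ
  have h2 : ‖((Real.sin φ / ω : ℝ) : ℂ)‖ ≤ 1 / ω := by
    rw [Complex.norm_real, Real.norm_eq_abs, abs_div, abs_of_pos hω]
    exact div_le_div_of_nonneg_right (Real.abs_sin_le_one φ) hω.le
  calc ‖((Real.cos φ : ℂ) + ((Real.sin φ / ω : ℝ) : ℂ) * x₀) * (c₀ * S₀) + ((Real.sin φ / ω : ℝ) : ℂ) * x₁ * (c₁ * S₁)‖
      ≤ ‖((Real.cos φ : ℂ) + ((Real.sin φ / ω : ℝ) : ℂ) * x₀) * (c₀ * S₀)‖ + ‖((Real.sin φ / ω : ℝ) : ℂ) * x₁ * (c₁ * S₁)‖ := norm_add_le _ _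
    _ = ‖(Real.cos φ : ℂ) + ((Real.sin φ / ω : ℝ) : ℂ) * x₀‖ * (‖c₀‖ * ‖S₀‖) + ‖((Real.sin φ / ω : ℝ) : ℂ)‖ * ‖x₁‖ * (‖c₁‖ * ‖S₁‖) := by
        simp only [norm_mul]
    _ ≤ ‖x₀‖ / ω * (‖c₀‖ * ‖S₀‖) + 1 / ω * ‖x₁‖ * (‖c₁‖ * ‖S₁‖) := by gcongr
    _ = _ := by ring

/-! ## §3 The Duhamel envelope bound -/

/-- **Duhamel envelope bound (main term first).** Stable row `cos(ω(θ−s))·1 + (sin(ω(θ−s))/ω)·(x₀, x₁)`, `x₀` purely imaginary with `‖x₀‖ ≥ ω > 0`,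
sources with the common pointwise envelope `‖Sᵢ(s)‖ ≤ E/√(1+s²)` (no integrability needed: a non-integrable integrand has integral `0`): the created
amplitude after strain `θ ≥ 0` is at most
`(‖x₀‖‖c₀‖ + ‖x₁‖‖c₁‖)/ω · E · arsinh θ`. [folklore] -/
theorem norm_duhamel_envelope_le {θ ω E : ℝ} {x₀ x₁ c₀ c₁ : ℂ} {S₀ S₁ : ℝ → ℂ} (hθ : 0 ≤ θ) (hω : 0 < ω) (hx₀ : x₀.re = 0)
    (hωx : ω ≤ ‖x₀‖) (hE₀ : ∀ s, ‖S₀ s‖ ≤ E / Real.sqrt (1 + s ^ 2))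
    (hE₁ : ∀ s, ‖S₁ s‖ ≤ E / Real.sqrt (1 + s ^ 2)) :
    ‖∫ s in (0 : ℝ)..θ, ((Real.cos (ω * (θ - s)) : ℂ) * (c₀ * S₀ s) +
        ((Real.sin (ω * (θ - s)) / ω : ℝ) : ℂ) * (x₀ * (c₀ * S₀ s) + x₁ * (c₁ * S₁ s)))‖ ≤
      (‖x₀‖ * ‖c₀‖ + ‖x₁‖ * ‖c₁‖) / ω * E * Real.arsinh θ := by
  have hE : 0 ≤ E := by
    have h := hE₀ 0
    simp only [ne_eq, OfNat.ofNat_ne_zero, not_false_eq_true, zero_pow, add_zero, Real.sqrt_one, div_one] at h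
    exact (norm_nonneg _).trans h
  have hg : IntervalIntegrable (fun s : ℝ => (‖x₀‖ * ‖c₀‖ + ‖x₁‖ * ‖c₁‖) / ω * (E / Real.sqrt (1 + s ^ 2))) volume 0 θ :=
    (continuous_const.mul (continuous_envelope E)).intervalIntegrable _ _
  have hpt : ∀ᵐ s : ℝ ∂volume, s ∈ Set.Ioc (0 : ℝ) θ →
      ‖(Real.cos (ω * (θ - s)) : ℂ) * (c₀ * S₀ s) + ((Real.sin (ω * (θ - s)) / ω : ℝ) : ℂ) * (x₀ * (c₀ * S₀ s) + x₁ * (c₁ * S₁ s))‖ ≤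
        (‖x₀‖ * ‖c₀‖ + ‖x₁‖ * ‖c₁‖) / ω * (E / Real.sqrt (1 + s ^ 2)) := by
    refine Filter.Eventually.of_forall fun s _ => ?_
    refine (norm_duhamel_integrand_le hx₀ hω hωx _).trans ?_
    rw [div_mul_eq_mul_div, add_mul]
    apply div_le_div_of_nonneg_right _ hω.le
    have h0 := hE₀ s
    have h1 := hE₁ s
    have := mul_le_mul_of_nonneg_left h0 (mul_nonneg (norm_nonneg x₀) (norm_nonneg c₀))
    have := mul_le_mul_of_nonneg_left h1 (mul_nonneg (norm_nonneg x₁) (norm_nonneg c₁))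
    linarith
  have h := intervalIntegral.norm_integral_le_of_norm_le hθ hpt hg
  rw [intervalIntegral.integral_const_mul, integral_envelope] at h
  linarith

/-- **Duhamel envelope bound (main term second)** — the other component: `cos·(c₁S₁) + (sin/ω)(x₀c₀S₀ + x₁c₁S₁)` with `x₁` purely imaginary,
`‖x₁‖ ≥ ω`: bound `(‖x₁‖‖c₁‖ + ‖x₀‖‖c₀‖)/ω · E · arsinh θ`. [folklore] -/
theorem norm_duhamel_envelope_le' {θ ω E : ℝ} {x₀ x₁ c₀ c₁ : ℂ} {S₀ S₁ : ℝ → ℂ} (hθ : 0 ≤ θ) (hω : 0 < ω) (hx₁ : x₁.re = 0)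
    (hωx : ω ≤ ‖x₁‖) (hE₀ : ∀ s, ‖S₀ s‖ ≤ E / Real.sqrt (1 + s ^ 2))
    (hE₁ : ∀ s, ‖S₁ s‖ ≤ E / Real.sqrt (1 + s ^ 2)) :
    ‖∫ s in (0 : ℝ)..θ, ((Real.cos (ω * (θ - s)) : ℂ) * (c₁ * S₁ s) +
        ((Real.sin (ω * (θ - s)) / ω : ℝ) : ℂ) * (x₀ * (c₀ * S₀ s) + x₁ * (c₁ * S₁ s)))‖ ≤
      (‖x₁‖ * ‖c₁‖ + ‖x₀‖ * ‖c₀‖) / ω * E * Real.arsinh θ := by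
  have e : (∫ s in (0 : ℝ)..θ, ((Real.cos (ω * (θ - s)) : ℂ) * (c₁ * S₁ s) +
        ((Real.sin (ω * (θ - s)) / ω : ℝ) : ℂ) * (x₀ * (c₀ * S₀ s) + x₁ * (c₁ * S₁ s)))) =
      ∫ s in (0 : ℝ)..θ, ((Real.cos (ω * (θ - s)) : ℂ) * (c₁ * S₁ s) +
        ((Real.sin (ω * (θ - s)) / ω : ℝ) : ℂ) * (x₁ * (c₁ * S₁ s) + x₀ * (c₀ * S₀ s))) :=
    intervalIntegral.integral_congr fun s _ => by simp only [add_comm]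
  rw [e]
  exact norm_duhamel_envelope_le hθ hω hx₁ hωx hE₁ hE₀

end Summit.AnomalousDissipation.AnomalousDissipation.Theorems.SawtoothPulseCascade.K2PhaseBudget

end
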